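import Mathlib
import Summits.Ventures.PercRepro2.Star3Worlds

/-!
# THE THREE-PIN STAR: the world `(1, 0, 1)` (`a₃ ≡ a₂ ≡ o`) (blind cell PercRepro2, night-1 g27;
proofs/NIGHT1-G26.md §7 (2), the world `('o', 'a2')` of star3core.py)

With `g = {a₃, o}` and `d = {a₃, a₂}` open and `e` closed, `o` is surely in `C₂`: on the base configuration
`Q` reads as `Q ∩ {a₁ ↮ o}` (`mem_Q_101`), `{a₁ ↔ o}` is impossible, `{a₂ ↔ o}` sure, `{a₁ ↔ b}` reads as
itself and `{a₂ ↔ b}` as `{a₂ ↔ b} ∪ {o ↔ b}` (the nine `Q ∩ X` readings `prob_Q_101_u` … `prob_Q_101_oHbH`);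
`PD = T′ = ∅` and `T = Q` (`prob_PD_101`, `prob_T'_101`, `prob_T_101`).  The base events are then converted
to the masses: `P(Q ∩ {a₁ ↮ o}) = Z − Lo` (`prob_Q_not_oL`), `P(Q ∩ {a₁ ↮ o} ∩ bL) = Lb − LL`
(`prob_Q_not_oL_bL`) and `P(Q ∩ {a₁ ↮ o} ∩ ({a₂ ↔ b} ∪ {o ↔ b})) = Hb − LH + W` with the coupling mass
`W = P(PD_o ∩ {o ↔ b})` (`prob_Q_not_oL_bH`).  Own code; standard axioms.
-/

namespace Summit.Ventures.PercRepro2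

open UnionCluster CovForm

namespace Mix

open OStar

namespace OStar3

section World101

variable {V : Type*} {E : Type*} [Fintype E] [DecidableEq E] {R : Type*} [Field R]

variable (p : E → R) {ends : E → Sym2 V} {g e d : E} {o a₁ a₂ a₃ b : V}
  (hg : ends g = s(a₃, o)) (hd : ends d = s(a₃, a₂))
  (hstar3 : ∀ e', a₃ ∈ ends e' → e' = g ∨ e' = e ∨ e' = d)
  (hge : g ≠ e) (hgd : g ≠ d) (hed : e ≠ d) (h13 : a₁ ≠ a₃) (h23 : a₂ ≠ a₃) (ho3 : o ≠ a₃) (hb3 : b ≠ a₃)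

omit [Fintype E] in
include hg hd hstar3 hge hgd hed h13 h23 in
/-- World `(1, 0, 1)`: `Q` reads as `Q ∩ {a₁ ↮ o}` on the base configuration. -/
lemma mem_Q_101 (ω : Config E) :
    Function.update (Function.update (Function.update ω g true) e false) d true ∈ avoidAll ends a₂ {a₁} ↔
      Function.update (Function.update (Function.update ω g false) e false) d false ∈
        avoidAll ends a₂ {a₁} ∩ (connEvent ends a₁ o)ᶜ := by
  rw [Set.mem_inter_iff, Set.mem_compl_iff, mem_Q_iff, mem_Q_iff, r101 hg hd hstar3 hge hgd hed h23 ω h23 h13]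
  constructor
  · intro h
    exact ⟨fun hA => h (Or.inl hA), fun hD => h (Or.inr (Or.inr ⟨conn_refl _ _ _, conn_symm hD⟩))⟩
  · rintro ⟨hA, hD⟩ (h | ⟨-, h⟩ | ⟨-, h⟩)
    · exact hA h
    · exact hA h
    · exact hD (conn_symm h)

include hg hd hstar3 hge hgd hed h13 h23 in
/-- `Q` in world `(1, 0, 1)`. -/
lemma prob_Q_101_u :
    prob (Function.update (Function.update (Function.update p g 1) e 0) d 1) (avoidAll ends a₂ {a₁}) =
      prob (Function.update (Function.update (Function.update p g 0) e 0) d 0)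
        (avoidAll ends a₂ {a₁} ∩ (connEvent ends a₁ o)ᶜ) := by
  rw [prob_w101, prob_w000]
  congr 1
  ext ω
  exact mem_Q_101 hg hd hstar3 hge hgd hed h13 h23 ω

include hg hd hstar3 hge hgd hed h13 h23 ho3 in
/-- `Q ∩ {a₁ ↔ o}` in world `(1, 0, 1)`: impossible. -/
lemma prob_Q_101_oL :
    prob (Function.update (Function.update (Function.update p g 1) e 0) d 1)
      (avoidAll ends a₂ {a₁} ∩ connEvent ends a₁ o) = 0 := by
  rw [prob_w101]
  have hempty : {ω : Config E | Function.update (Function.update (Function.update ω g true) e false) d true ∈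
      avoidAll ends a₂ {a₁} ∩ connEvent ends a₁ o} = ∅ := by
    ext ω
    simp only [Set.mem_setOf_eq, Set.mem_empty_iff_false, iff_false]
    rw [Set.mem_inter_iff, mem_Q_101 hg hd hstar3 hge hgd hed h13 h23 ω]
    simp only [Set.mem_inter_iff, Set.mem_compl_iff, mem_Q_iff]
    rintro ⟨⟨hA, hD⟩, h⟩
    rcases (r101 hg hd hstar3 hge hgd hed h23 ω h13 ho3).1 h with h' | ⟨h', -⟩ | ⟨h', -⟩
    · exact hD h'
    · exact hD h'
    · exact hA (conn_symm h')
  rw [hempty, prob_empty]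

include hg hd hstar3 hge hgd hed h13 h23 ho3 in
/-- `Q ∩ {a₂ ↔ o}` in world `(1, 0, 1)`: `o ∈ C₂` surely. -/
lemma prob_Q_101_oH :
    prob (Function.update (Function.update (Function.update p g 1) e 0) d 1)
      (avoidAll ends a₂ {a₁} ∩ connEvent ends a₂ o) =
      prob (Function.update (Function.update (Function.update p g 0) e 0) d 0)
        (avoidAll ends a₂ {a₁} ∩ (connEvent ends a₁ o)ᶜ) := by
  rw [prob_w101, prob_w000]
  congr 1
  ext ω
  simp only [Set.mem_setOf_eq]
  rw [Set.mem_inter_iff, mem_Q_101 hg hd hstar3 hge hgd hed h13 h23 ω]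
  constructor
  · exact fun h => h.1
  · intro h
    refine ⟨h, ?_⟩
    show Conn ends _ a₂ o
    rw [r101 hg hd hstar3 hge hgd hed h23 ω h23 ho3]
    exact Or.inr (Or.inr ⟨conn_refl _ _ _, conn_refl _ _ _⟩)

include hg hd hstar3 hge hgd hed h13 h23 hb3 in
/-- `Q ∩ {a₁ ↔ b}` in world `(1, 0, 1)`: reads as itself. -/
lemma prob_Q_101_bL :
    prob (Function.update (Function.update (Function.update p g 1) e 0) d 1)
      (avoidAll ends a₂ {a₁} ∩ connEvent ends a₁ b) =
      prob (Function.update (Function.update (Function.update p g 0) e 0) d 0)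
        (avoidAll ends a₂ {a₁} ∩ (connEvent ends a₁ o)ᶜ ∩ connEvent ends a₁ b) := by
  rw [prob_w101, prob_w000]
  congr 1
  ext ω
  simp only [Set.mem_setOf_eq]
  rw [Set.mem_inter_iff, mem_Q_101 hg hd hstar3 hge hgd hed h13 h23 ω]
  simp only [Set.mem_inter_iff, Set.mem_compl_iff, mem_Q_iff]
  constructor
  · rintro ⟨⟨hA, hD⟩, h⟩
    refine ⟨⟨hA, hD⟩, ?_⟩
    rcases (r101 hg hd hstar3 hge hgd hed h23 ω h13 hb3).1 h with h' | ⟨h', -⟩ | ⟨h', -⟩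
    · exact h'
    · exact absurd h' hD
    · exact absurd (conn_symm h') hA
  · rintro ⟨⟨hA, hD⟩, h⟩
    refine ⟨⟨hA, hD⟩, ?_⟩
    show Conn ends _ a₁ b
    rw [r101 hg hd hstar3 hge hgd hed h23 ω h13 hb3]
    exact Or.inl h

include hg hd hstar3 hge hgd hed h13 h23 hb3 in
/-- `Q ∩ {a₂ ↔ b}` in world `(1, 0, 1)`: reads as `{a₂ ↔ b} ∪ {o ↔ b}`. -/
lemma prob_Q_101_bH :
    prob (Function.update (Function.update (Function.update p g 1) e 0) d 1)
      (avoidAll ends a₂ {a₁} ∩ connEvent ends a₂ b) =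
      prob (Function.update (Function.update (Function.update p g 0) e 0) d 0)
        (avoidAll ends a₂ {a₁} ∩ (connEvent ends a₁ o)ᶜ ∩ (connEvent ends a₂ b ∪ connEvent ends o b)) := by
  rw [prob_w101, prob_w000]
  congr 1
  ext ω
  simp only [Set.mem_setOf_eq]
  rw [Set.mem_inter_iff, mem_Q_101 hg hd hstar3 hge hgd hed h13 h23 ω]
  simp only [Set.mem_inter_iff, Set.mem_union]
  constructor
  · rintro ⟨hQ, h⟩
    refine ⟨hQ, ?_⟩
    rcases (r101 hg hd hstar3 hge hgd hed h23 ω h23 hb3).1 h with h' | ⟨-, h'⟩ | ⟨-, h'⟩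
    · exact Or.inl h'
    · exact Or.inl h'
    · exact Or.inr h'
  · rintro ⟨hQ, h⟩
    refine ⟨hQ, ?_⟩
    show Conn ends _ a₂ b
    rw [r101 hg hd hstar3 hge hgd hed h23 ω h23 hb3]
    rcases h with h | h
    · exact Or.inl h
    · exact Or.inr (Or.inr ⟨conn_refl _ _ _, h⟩)

include hg hd hstar3 hge hgd hed h13 h23 ho3 in
/-- `Q ∩ ({a₁ ↔ o} ∩ X)` in world `(1, 0, 1)`: impossible. -/
lemma prob_Q_101_oLX (X : Set (Config E)) :
    prob (Function.update (Function.update (Function.update p g 1) e 0) d 1)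
      (avoidAll ends a₂ {a₁} ∩ (connEvent ends a₁ o ∩ X)) = 0 := by
  rw [prob_w101]
  have hempty : {ω : Config E | Function.update (Function.update (Function.update ω g true) e false) d true ∈
      avoidAll ends a₂ {a₁} ∩ (connEvent ends a₁ o ∩ X)} = ∅ := by
    ext ω
    simp only [Set.mem_setOf_eq, Set.mem_empty_iff_false, iff_false]
    rw [Set.mem_inter_iff, mem_Q_101 hg hd hstar3 hge hgd hed h13 h23 ω]
    simp only [Set.mem_inter_iff, Set.mem_compl_iff, mem_Q_iff]
    rintro ⟨⟨hA, hD⟩, h, -⟩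
    rcases (r101 hg hd hstar3 hge hgd hed h23 ω h13 ho3).1 h with h' | ⟨h', -⟩ | ⟨h', -⟩
    · exact hD h'
    · exact hD h'
    · exact hA (conn_symm h')
  rw [hempty, prob_empty]

include hg hd hstar3 hge hgd hed h23 ho3 in
/-- `Q ∩ ({a₂ ↔ o} ∩ X)` in world `(1, 0, 1)`: `{a₂ ↔ o}` is sure. -/
lemma prob_Q_101_oHX (X : Set (Config E)) :
    prob (Function.update (Function.update (Function.update p g 1) e 0) d 1)
      (avoidAll ends a₂ {a₁} ∩ (connEvent ends a₂ o ∩ X)) =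
      prob (Function.update (Function.update (Function.update p g 1) e 0) d 1) (avoidAll ends a₂ {a₁} ∩ X) := by
  rw [prob_w101, prob_w101]
  congr 1
  ext ω
  simp only [Set.mem_setOf_eq, Set.mem_inter_iff]
  constructor
  · rintro ⟨hQ, -, h⟩
    exact ⟨hQ, h⟩
  · rintro ⟨hQ, h⟩
    refine ⟨hQ, ?_, h⟩
    show Conn ends _ a₂ o
    rw [r101 hg hd hstar3 hge hgd hed h23 ω h23 ho3]
    exact Or.inr (Or.inr ⟨conn_refl _ _ _, conn_refl _ _ _⟩)

include hg hd hstar3 hge hgd hed h23 in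
/-- `PD ∩ X` in world `(1, 0, 1)`: impossible (`a₃ ↔ a₂`). -/
lemma prob_PD_101 (X : Set (Config E)) :
    prob (Function.update (Function.update (Function.update p g 1) e 0) d 1) (PDEvent ends a₁ a₂ a₃ ∩ X) = 0 := by
  rw [prob_w101]
  have hempty : {ω : Config E | Function.update (Function.update (Function.update ω g true) e false) d true ∈
      PDEvent ends a₁ a₂ a₃ ∩ X} = ∅ := by
    ext ω
    simp only [Set.mem_setOf_eq, Set.mem_inter_iff, mem_PD_iff, Set.mem_empty_iff_false, iff_false]
    rintro ⟨⟨-, -, h⟩, -⟩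
    apply h
    rw [r101a' hg hd hstar3 hge hgd hed h23 ω h23]
    exact Or.inr (conn_refl _ _ _)
  rw [hempty, prob_empty]

include hg hd hstar3 hge hgd hed h13 h23 in
/-- `T′ ∩ X` in world `(1, 0, 1)`: impossible (`a₁ ↔ a₃` would join `a₁` to `o` or `a₂`). -/
lemma prob_T'_101 (X : Set (Config E)) :
    prob (Function.update (Function.update (Function.update p g 1) e 0) d 1) (TEvent ends a₂ a₁ a₃ ∩ X) = 0 := by
  rw [prob_w101]
  have hempty : {ω : Config E | Function.update (Function.update (Function.update ω g true) e false) d true ∈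
      TEvent ends a₂ a₁ a₃ ∩ X} = ∅ := by
    ext ω
    simp only [Set.mem_setOf_eq, Set.mem_inter_iff, mem_T_iff, Set.mem_empty_iff_false, iff_false]
    rintro ⟨⟨h, h'⟩, -⟩
    apply h
    rw [r101 hg hd hstar3 hge hgd hed h23 ω h13 h23]
    rcases (r101a hg hd hstar3 hge hgd hed h23 ω h13).1 h' with h'' | h''
    · exact Or.inr (Or.inl ⟨h'', conn_refl _ _ _⟩)
    · exact Or.inl h''
  rw [hempty, prob_empty]

include hg hd hstar3 hge hgd hed h23 in
/-- `T ∩ X` in world `(1, 0, 1)`: `T = Q` there (`a₃ ↔ a₂`). -/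
lemma prob_T_101 (X : Set (Config E)) :
    prob (Function.update (Function.update (Function.update p g 1) e 0) d 1) (TEvent ends a₁ a₂ a₃ ∩ X) =
      prob (Function.update (Function.update (Function.update p g 1) e 0) d 1) (avoidAll ends a₂ {a₁} ∩ X) := by
  rw [prob_w101, prob_w101]
  congr 1
  ext ω
  simp only [Set.mem_setOf_eq, Set.mem_inter_iff, mem_T_iff, mem_Q_iff]
  constructor
  · rintro ⟨⟨h, -⟩, h'⟩
    exact ⟨h, h'⟩
  · rintro ⟨h, h'⟩
    refine ⟨⟨h, ?_⟩, h'⟩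
    rw [r101a hg hd hstar3 hge hgd hed h23 ω h23]
    exact Or.inr (conn_refl _ _ _)

end World101

/-! ## The base events of the world `(1, 0, 1)` as masses -/

section Masses101

variable {V : Type*} {E : Type*} [Fintype E] [DecidableEq E] {R : Type*} [Field R]

variable (p : E → R) (ends : E → Sym2 V) (o a₁ a₂ b : V)

/-- `P(Q ∩ {a₁ ↮ o}) = P(Q) − P(Q ∩ {a₁ ↔ o})`. -/
lemma prob_Q_not_oL :
    prob p (avoidAll ends a₂ {a₁} ∩ (connEvent ends a₁ o)ᶜ) =
      prob p (avoidAll ends a₂ {a₁}) - prob p (avoidAll ends a₂ {a₁} ∩ connEvent ends a₁ o) := by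
  have h := prob_inter_add_prob_inter_compl p (avoidAll ends a₂ {a₁}) (connEvent ends a₁ o)
  linear_combination h

/-- `P(Q ∩ {a₁ ↮ o} ∩ {a₁ ↔ b}) = P(Q ∩ {a₁ ↔ b}) − P(Q ∩ ({a₁ ↔ o} ∩ {a₁ ↔ b}))`. -/
lemma prob_Q_not_oL_bL :
    prob p (avoidAll ends a₂ {a₁} ∩ (connEvent ends a₁ o)ᶜ ∩ connEvent ends a₁ b) =
      prob p (avoidAll ends a₂ {a₁} ∩ connEvent ends a₁ b) -
        prob p (avoidAll ends a₂ {a₁} ∩ (connEvent ends a₁ o ∩ connEvent ends a₁ b)) := by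
  have h := prob_inter_add_prob_inter_compl p (avoidAll ends a₂ {a₁} ∩ connEvent ends a₁ b) (connEvent ends a₁ o)
  have e1 : avoidAll ends a₂ {a₁} ∩ connEvent ends a₁ b ∩ connEvent ends a₁ o =
      avoidAll ends a₂ {a₁} ∩ (connEvent ends a₁ o ∩ connEvent ends a₁ b) := by
    ext ω; simp only [Set.mem_inter_iff]; tauto
  have e2 : avoidAll ends a₂ {a₁} ∩ connEvent ends a₁ b ∩ (connEvent ends a₁ o)ᶜ =
      avoidAll ends a₂ {a₁} ∩ (connEvent ends a₁ o)ᶜ ∩ connEvent ends a₁ b := by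
    ext ω; simp only [Set.mem_inter_iff, Set.mem_compl_iff]; tauto
  rw [e1, e2] at h
  linear_combination h

omit [Fintype E] [DecidableEq E] in
/-- `Q ∩ {a₁ ↮ o} ∩ {a₂ ↮ b} ∩ {o ↔ b} = PD_o ∩ {o ↔ b}`. -/
lemma Q_not_oL_not_bH_ob_eq :
    avoidAll ends a₂ {a₁} ∩ (connEvent ends a₁ o)ᶜ ∩ (connEvent ends a₂ b)ᶜ ∩ connEvent ends o b =
      PDEvent ends a₁ a₂ o ∩ connEvent ends o b := by
  ext ω
  simp only [Set.mem_inter_iff, Set.mem_compl_iff, mem_Q_iff', mem_PD_iff]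
  constructor
  · rintro ⟨⟨⟨h12, h1o⟩, h2b⟩, hob⟩
    refine ⟨⟨h12, fun h => h1o (conn_symm h), fun h => h2b (conn_trans (conn_symm h) hob)⟩, hob⟩
  · rintro ⟨⟨h12, ho1, ho2⟩, hob⟩
    exact ⟨⟨⟨h12, fun h => ho1 (conn_symm h)⟩, fun h => ho2 (conn_trans hob (conn_symm h))⟩, hob⟩

/-- `P(Q ∩ {a₁ ↮ o} ∩ ({a₂ ↔ b} ∪ {o ↔ b})) = P(Q ∩ bH) − P(Q ∩ (oL ∩ bH)) + P(PD_o ∩ {o ↔ b})`. -/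
lemma prob_Q_not_oL_bH :
    prob p (avoidAll ends a₂ {a₁} ∩ (connEvent ends a₁ o)ᶜ ∩ (connEvent ends a₂ b ∪ connEvent ends o b)) =
      prob p (avoidAll ends a₂ {a₁} ∩ connEvent ends a₂ b) -
        prob p (avoidAll ends a₂ {a₁} ∩ (connEvent ends a₁ o ∩ connEvent ends a₂ b)) +
        prob p (PDEvent ends a₁ a₂ o ∩ connEvent ends o b) := by
  -- split the union along `{a₂ ↔ b}`
  have hsplit : avoidAll ends a₂ {a₁} ∩ (connEvent ends a₁ o)ᶜ ∩ (connEvent ends a₂ b ∪ connEvent ends o b) =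
      (avoidAll ends a₂ {a₁} ∩ (connEvent ends a₁ o)ᶜ ∩ connEvent ends a₂ b) ∪
        (avoidAll ends a₂ {a₁} ∩ (connEvent ends a₁ o)ᶜ ∩ (connEvent ends a₂ b)ᶜ ∩ connEvent ends o b) := by
    ext ω; simp only [Set.mem_inter_iff, Set.mem_union, Set.mem_compl_iff]; tauto
  have hdisj : Disjoint (avoidAll ends a₂ {a₁} ∩ (connEvent ends a₁ o)ᶜ ∩ connEvent ends a₂ b)
      (avoidAll ends a₂ {a₁} ∩ (connEvent ends a₁ o)ᶜ ∩ (connEvent ends a₂ b)ᶜ ∩ connEvent ends o b) := by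
    rw [Set.disjoint_left]
    rintro ω ⟨-, h⟩ ⟨⟨-, h'⟩, -⟩
    exact h' h
  rw [hsplit, prob_union_of_disjoint p hdisj, Q_not_oL_not_bH_ob_eq]
  have h := prob_inter_add_prob_inter_compl p (avoidAll ends a₂ {a₁} ∩ connEvent ends a₂ b) (connEvent ends a₁ o)
  have e1 : avoidAll ends a₂ {a₁} ∩ connEvent ends a₂ b ∩ connEvent ends a₁ o =
      avoidAll ends a₂ {a₁} ∩ (connEvent ends a₁ o ∩ connEvent ends a₂ b) := by
    ext ω; simp only [Set.mem_inter_iff]; tauto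
  have e2 : avoidAll ends a₂ {a₁} ∩ connEvent ends a₂ b ∩ (connEvent ends a₁ o)ᶜ =
      avoidAll ends a₂ {a₁} ∩ (connEvent ends a₁ o)ᶜ ∩ connEvent ends a₂ b := by
    ext ω; simp only [Set.mem_inter_iff, Set.mem_compl_iff]; tauto
  rw [e1, e2] at h
  linear_combination h

end Masses101

end OStar3

end Mix

end Summit.Ventures.PercRepro2
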